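import Literature.NumberTheory.Sieve.UnitKernelLattice
import Literature.Algebra.EuclideanLattices.LatticePeriodicFunctions
import HarnessLib

/-!
# Sums of a log-weight over the units of `U_𝔣` as a periodization over the lattice `L_𝔣`

Topic `Literature/NumberTheory/Sieve`, sub-namespace `UnitPeriodic`. Second brick of the harmonic
analysis of the smooth character sums `Θ_{Ω'}(χ)` on the unit torus (Mitsui 1956 §3, Hecke 1920
§1), for a totally real field `K` of degree `d`. A *log-weight* is a function `W` of the vector
`(log |σ_w α|)_w ∈ ℝ^{places}`; for a unit `η`, `log|σ(ηα)| = log|σ η| + log|σ α|`. Splitting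
`y ∈ ℝ^{places}` into the norm coordinate `t = (1/d) ∑_w y_w` and the trace-zero part
`h = (y_w − t)_{w ≠ w₀} ∈ logSpace K` (`toTH`, inverse `ofTH`), the logarithm vector of a totally
positive unit `η` becomes `(0, logEmbedding η)`, and summing over the subgroup `U_𝔣 = kerPosUnits χ`
of `UnitKernelLattice` gives the **periodization** of `h ↦ W(ofTH(t, h))` over the full lattice
`L_𝔣 = kerLattice χ` of `logSpace K` (`Literature.Algebra.EuclideanLattices.LatticePeriodic.periodize`):

* `logVec α = (log (w α))_w`, `logVec_mul`, `logVec_unit`;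
* `toTH`, `ofTH`, `ofTH_toTH`, `toTH_logVec_unit` (`= (0, logEmbedding η)` for `η ∈ U⁺`);
* `logEmbedding_injOn_posUnits`, `kerUnitsEquiv χ : kerPosUnits χ ≃ kerLattice χ`;
* **`tsum_kerPosUnits_eq_periodize`** —
  `∑'_{η ∈ U_𝔣} W(logVec(ηα)) = periodize L_𝔣 (fun h ↦ W (ofTH (t_α, h))) h_α`.

## References

* T. Mitsui, Jap. J. Math. 26 (1956), §3. [cite: Mitsui1956, §3]
* E. Hecke, Math. Z. 6 (1920), §1. [cite: HeckeMathZ1920, §1]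

## Mathlib / tree search

Tree: `UnitKernel.kerPosUnits/kerLattice/exists_of_mem_kerLattice/logEmbedding_mem_kerLattice`,
`HeckeCone.posUnits`, `mem_posUnits_iff`, `LatticePeriodic.periodize`. Mathlib:
`logEmbedding_component`, `sum_logEmbedding_component`, `logEmbedding_eq_zero_iff`, `mem_torsion`.
-/

noncomputable section

open NumberField NumberField.InfinitePlace NumberField.Units NumberField.Units.dirichletUnitTheorem
  Literature.NumberTheory.LFunctions Literature.NumberTheory.LFunctions.HeckeCone
  Literature.NumberTheory.Sieve.UnitKernel Literature.Algebra.EuclideanLattices.LatticePeriodic Module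
open scoped Classical

namespace Literature.NumberTheory.Sieve.UnitPeriodic

variable {K : Type*} [Field K] [NumberField K]

local notation "d" => Module.finrank ℚ K

/-! ## The logarithm vector of an element -/

variable (K) in
/-- `logVec α = (log (w α))_w`, `w α = |σ_w α|`. [folklore] -/
def logVec (α : K) : InfinitePlace K → ℝ := fun w => Real.log (w α)

omit [NumberField K] in
/-- `logVec (α β) = logVec α + logVec β` for `α, β ≠ 0`. [folklore] -/
theorem logVec_mul {α β : K} (hα : α ≠ 0) (hβ : β ≠ 0) : logVec K (α * β) = logVec K α + logVec K β := by
  funext w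
  simp only [logVec, Pi.add_apply, map_mul]
  rw [Real.log_mul ((map_ne_zero w).2 hα) ((map_ne_zero w).2 hβ)]

/-! ## The `(t, h)` coordinates -/

variable (K) in
/-- `toTH y = (t, h)`: `t = (1/d) ∑_w e_w y_w`, `h_w = e_w (y_w − t)` (`w ≠ w₀`; `e_w = mult w`, `= 1` for
real places). [folklore] -/
def toTH (y : InfinitePlace K → ℝ) : ℝ × logSpace K :=
  ((∑ w, (mult w : ℝ) * y w) / d, fun w => (mult w.1 : ℝ) * (y w.1 - (∑ w', (mult w' : ℝ) * y w') / d))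

/-- `toTH` is additive. [folklore] -/
theorem toTH_add (y y' : InfinitePlace K → ℝ) : toTH K (y + y') = toTH K y + toTH K y' := by
  simp only [toTH, Pi.add_apply, Prod.mk_add_mk, Prod.mk.injEq]
  constructor
  · rw [← add_div, ← Finset.sum_add_distrib]
    congr 1
    exact Finset.sum_congr rfl fun w _ => by ring
  · funext w
    simp only [Pi.add_apply]
    rw [Finset.sum_congr rfl fun w' _ => (mul_add (mult w' : ℝ) (y w') (y' w'))]
    rw [Finset.sum_add_distrib, add_div]
    ring

/-- **The logarithm vector of a unit in `(t, h)` coordinates is `(0, logEmbedding)`.** [folklore] -/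
theorem toTH_logVec_unit (η : (𝓞 K)ˣ) :
    toTH K (logVec K ((η : 𝓞 K) : K)) = (0, logEmbedding K (Additive.ofMul η)) := by
  have hsum : ∑ w : InfinitePlace K, (mult w : ℝ) * logVec K ((η : 𝓞 K) : K) w = 0 := by
    have h := sum_logEmbedding_component η
    -- `∑_{w ≠ w₀} e_w log w η = - e_{w₀} log w₀ η`
    rw [Fintype.sum_eq_add_sum_subtype_ne _ w₀]
    have h2 : ∑ w : {w : InfinitePlace K // w ≠ w₀}, (mult w.1 : ℝ) * logVec K ((η : 𝓞 K) : K) w.1 =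
        ∑ w : {w : InfinitePlace K // w ≠ w₀}, logEmbedding K (Additive.ofMul η) w := by
      refine Finset.sum_congr rfl fun w _ => ?_
      rw [logEmbedding_component]; rfl
    rw [h2, h]
    simp [logVec]
  simp only [toTH, hsum, zero_div, sub_zero, Prod.mk.injEq, true_and]
  funext w
  rw [logEmbedding_component]; rfl

variable (K) in
/-- The inverse coordinate map `ofTH (t, h)`: `y_w = t + h_w/e_w` (`w ≠ w₀`),
`y_{w₀} = t − (∑_{w ≠ w₀} h_w)/e_{w₀}`. [folklore] -/
def ofTH (p : ℝ × logSpace K) : InfinitePlace K → ℝ := fun w =>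
  if hw : w = w₀ then p.1 - (∑ w', p.2 w') / (mult w : ℝ) else p.1 + p.2 ⟨w, hw⟩ / (mult w : ℝ)

/-- `ofTH` is additive. [folklore] -/
theorem ofTH_add (p q : ℝ × logSpace K) : ofTH K (p + q) = ofTH K p + ofTH K q := by
  funext w
  simp only [ofTH, Prod.fst_add, Prod.snd_add, Pi.add_apply]
  split_ifs with hw
  · rw [Finset.sum_add_distrib]; ring
  · ring

/-- **`ofTH (toTH y) = y`.** [folklore] -/
theorem ofTH_toTH (y : InfinitePlace K → ℝ) : ofTH K (toTH K y) = y := by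
  have hmult : ∀ w : InfinitePlace K, (mult w : ℝ) ≠ 0 := fun w => by
    rw [mult]; split_ifs <;> norm_num
  funext w
  simp only [ofTH, toTH]
  set T : ℝ := (∑ w', (mult w' : ℝ) * y w') / d with hT
  split_ifs with hw
  · subst hw
    -- `∑_{w ≠ w₀} e_w (y_w − T) = (∑_w e_w y_w) − e_{w₀} y_{w₀} − T (d − e_{w₀})` and `∑ e_w = d`
    have hsum : ∑ w : {w : InfinitePlace K // w ≠ w₀}, (mult w.1 : ℝ) * (y w.1 - T) =
        (mult (w₀ : InfinitePlace K) : ℝ) * (T - y w₀) := by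
      have h1 : ∑ w : InfinitePlace K, (mult w : ℝ) * (y w - T) = 0 := by
        rw [Finset.sum_congr rfl fun w _ => (mul_sub (mult w : ℝ) (y w) T), Finset.sum_sub_distrib, ← Finset.sum_mul]
        have hd : ∑ w : InfinitePlace K, (mult w : ℝ) = d := by exact_mod_cast sum_mult_eq (K := K)
        rw [hd, hT, mul_div_cancel₀ _ (by exact_mod_cast Module.finrank_pos.ne')]
        ring
      rw [Fintype.sum_eq_add_sum_subtype_ne _ w₀] at h1
      linarith
    rw [hsum]
    field_simp
    ring
  · field_simp
    ring

/-! ## `U_𝔣 ≃ L_𝔣` -/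

/-- A totally positive torsion unit of a totally real field is `1`. [folklore] -/
theorem eq_one_of_mem_posUnits_of_mem_torsion [IsTotallyReal K] {u : (𝓞 K)ˣ} (hu : u ∈ posUnits K) (ht : u ∈ torsion K) :
    u = 1 := by
  obtain ⟨w⟩ := (inferInstance : Nonempty (InfinitePlace K))
  have hw : IsReal w := IsTotallyReal.isReal w
  set φ : K →+* ℝ := embedding_of_isReal hw with hφ
  have h1 : ‖φ ((u : 𝓞 K) : K)‖ = 1 := by rw [hφ, norm_embedding_of_isReal]; exact (mem_torsion K).1 ht w
  have h2 : 0 < φ ((u : 𝓞 K) : K) := hu φ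
  rw [Real.norm_eq_abs, abs_of_pos h2] at h1
  have h3 : ((u : 𝓞 K) : K) = 1 := φ.injective (by rw [h1, map_one])
  have h4 : (u : 𝓞 K) = 1 := by exact_mod_cast h3
  exact Units.ext h4

/-- **`logEmbedding` is injective on the totally positive units** (totally real `K`). [folklore] -/
theorem logEmbedding_injOn_posUnits [IsTotallyReal K] {u v : (𝓞 K)ˣ} (hu : u ∈ posUnits K) (hv : v ∈ posUnits K)
    (h : logEmbedding K (Additive.ofMul u) = logEmbedding K (Additive.ofMul v)) : u = v := by
  have h1 : logEmbedding K (Additive.ofMul (u * v⁻¹)) = 0 := by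
    rw [ofMul_mul, ofMul_inv, map_add, map_neg, h, add_neg_cancel]
  have h2 := eq_one_of_mem_posUnits_of_mem_torsion ((posUnits K).mul_mem hu ((posUnits K).inv_mem hv))
    (logEmbedding_eq_zero_iff.1 h1)
  exact mul_inv_eq_one.1 h2

variable {𝔣 : Ideal (𝓞 K)}

/-- **`U_𝔣 ≃ L_𝔣`**, `η ↦ log η`. [folklore] -/
def kerUnitsEquiv [IsTotallyReal K] (χ : AddChar (Additive ((𝓞 K ⧸ 𝔣)ˣ)) ℂ) : kerPosUnits χ ≃ kerLattice χ where
  toFun η := ⟨logEmbedding K (Additive.ofMul (η : (𝓞 K)ˣ)), logEmbedding_mem_kerLattice η.2⟩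
  invFun ℓ := ⟨(exists_of_mem_kerLattice ℓ.2).choose, (exists_of_mem_kerLattice ℓ.2).choose_spec.1⟩
  left_inv η := by
    apply Subtype.ext
    have hspec := (exists_of_mem_kerLattice (logEmbedding_mem_kerLattice (χ := χ) η.2)).choose_spec
    exact logEmbedding_injOn_posUnits (kerPosUnits_le χ hspec.1) (kerPosUnits_le χ η.2) hspec.2
  right_inv ℓ := by
    apply Subtype.ext
    exact (exists_of_mem_kerLattice ℓ.2).choose_spec.2

/-- The value of `kerUnitsEquiv`. [folklore] -/
theorem kerUnitsEquiv_apply [IsTotallyReal K] (χ : AddChar (Additive ((𝓞 K ⧸ 𝔣)ˣ)) ℂ) (η : kerPosUnits χ) :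
    ((kerUnitsEquiv χ η : kerLattice χ) : logSpace K) = logEmbedding K (Additive.ofMul (η : (𝓞 K)ˣ)) := rfl

/-! ## The unit sum as a periodization -/

/-- **The sum of a log-weight over `U_𝔣 α` is the periodization over `L_𝔣`**:
`∑'_{η ∈ U_𝔣} W(logVec(ηα)) = periodize L_𝔣 (h ↦ W (ofTH (t_α, h))) h_α`, `(t_α, h_α) = toTH (logVec α)`,
for `α ≠ 0`. [cite: Mitsui1956, §3] -/
theorem tsum_kerPosUnits_eq_periodize [IsTotallyReal K] (χ : AddChar (Additive ((𝓞 K ⧸ 𝔣)ˣ)) ℂ)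
    (W : (InfinitePlace K → ℝ) → ℝ) {α : K} (hα : α ≠ 0) :
    ∑' η : kerPosUnits χ, W (logVec K ((((η : (𝓞 K)ˣ) : 𝓞 K) : K) * α)) =
      periodize (kerLattice χ) (fun h => W (ofTH K ((toTH K (logVec K α)).1, h))) (toTH K (logVec K α)).2 := by
  unfold periodize
  rw [← (kerUnitsEquiv χ).tsum_eq]
  refine tsum_congr fun η => ?_
  congr 1
  have hη0 : (((η : (𝓞 K)ˣ) : 𝓞 K) : K) ≠ 0 := by exact_mod_cast (η : (𝓞 K)ˣ).ne_zero
  rw [logVec_mul hη0 hα, ← ofTH_toTH (logVec K ((((η : (𝓞 K)ˣ) : 𝓞 K) : K)) + logVec K α), toTH_add, toTH_logVec_unit]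
  congr 1
  rw [kerUnitsEquiv_apply]
  ext <;> simp [add_comm]

end Literature.NumberTheory.Sieve.UnitPeriodic
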